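import Mathlib
import Summits.Ventures.PercRepro2.Defs
import Summits.Ventures.PercRepro2.Independence
import Summits.Ventures.PercRepro2.Harris
import Summits.Ventures.PercRepro2.Graph
import Summits.Ventures.PercRepro2.Exploration
import Summits.Ventures.PercRepro2.Events
import Summits.Ventures.PercRepro2.FourFunctions
import Summits.Ventures.PercRepro2.Induced
import Summits.Ventures.PercRepro2.Frontier
import Summits.Ventures.PercRepro2.ObsIndependence
import Summits.Ventures.PercRepro2.BHK
import Summits.Ventures.PercRepro2.BHKEvents
import Summits.Ventures.PercRepro2.VdBKahn
import Summits.Ventures.PercRepro2.BHKAvoid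
import Summits.Ventures.PercRepro2.R2PrimeThreeReduction
import Summits.Ventures.PercRepro2.YBridge
import Summits.Ventures.PercRepro2.Yu1Functionals
import Summits.Ventures.PercRepro2.Yu1Events
import Summits.Ventures.PercRepro2.Yu1
import Summits.Ventures.PercRepro2.LBSplit
import Summits.Ventures.PercRepro2.YDelta
import Summits.Ventures.PercRepro2.YDeltaTools
import Summits.Ventures.PercRepro2.SD
import Summits.Ventures.PercRepro2.Lambda
import Summits.Ventures.PercRepro2.LambdaTau
import Summits.Ventures.PercRepro2.LambdaSlack
import Summits.Ventures.PercRepro2.ZDelta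

/-!
# The crux along an edge line: the quadratic identity and the polarised form (blind cell
PercRepro2, typer-1; mine-1 g6 `MINE-1.md` §19.1–19.2, ask 2026-08-23T04:06:31Z)

Every probability is affine in each edge weight (`prob_eq_pin`), so with the coordinate vector
`v(p) = (D, D_o, W, X)` (`vD`, `vDo`, `vW`, `vX`; `X = (T_{l→h} − Δ_l) + (T_{h→l} − Δ_h)`) the
(ZΔ)-slack is the quadratic form `Zq p = D_o W − D X` (`Zq_eq_slack`, `ZDelta_iff_Zq`) and along the
line `p_e = ε` between `v_d = v(p[e ↦ 0])` (edge deleted) and `v_c = v(p[e ↦ 1])` (edge contracted):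

* **`Z_edge_line`**: `Z(p) = (1 − p_e)² Z_d + 2 p_e (1 − p_e) B(v_d, v_c) + p_e² Z_c`, with the polarised
  form kept DOUBLED and division-free, `polar2 p q = 2B = D_o W′ + D′_o W − D X′ − D′ X`
  (`polar2_self : 2B(v, v) = 2Z`, `polar2_eq : 2B = Z_d + Z_c − ΔD_o ΔW + ΔD ΔX`);
* the labelling gap `labelGap = P(a₂ ↔ b) − P(a₁ ↔ b)` is affine (`labelGap_pin`); its zero on the
  line is `tiePoint = gap_d / (gap_d − gap_c)` (`labelGap_tiePoint`);
* the mixed coefficients of the labelled sub-segments are polarised forms with the tie point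
  (`polar2_tie_right : 2B(v(ε₀), v_c) = (1 − ε₀) 2B(v_d, v_c) + ε₀ 2Z_c`, `polar2_tie_left`);
* Props **`Polar`** (mine-1's POLAR: `B(v_d, v_c) ≥ 0` on a no-flip line), **`SegPolarUp`** /
  **`SegPolarDown`** (SEG-POLAR on the labelled sub-segment of a flip line), with closures
  `Polar_all`, `SegPolar_all` (census 0 / 120,923,258 and 0 / 35,538,502 lines at n = 7; by mine-1's
  LEMMA 19.3, `Polar ∧ SegPolar ∧ (T)` implies (ZΔ) by induction on the fractional edges).
-/

namespace Summit.Ventures.PercRepro2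

namespace ZLine

section Vec

variable {V : Type*} {E : Type*} [Fintype E] [DecidableEq E] {R : Type*} [Field R]

/-- `D = P(PD)`. -/
noncomputable def vD (p : E → R) (ends : E → Sym2 V) (a₁ a₂ a₃ : V) : R :=
  prob p (PDEvent ends a₁ a₂ a₃)

/-- `D_o = P(PD, o ∈ C₁) + P(PD, o ∈ C₂)`. -/
noncomputable def vDo (p : E → R) (ends : E → Sym2 V) (o a₁ a₂ a₃ : V) : R :=
  prob p (PDEvent ends a₁ a₂ a₃ ∩ connEvent ends a₁ o) +
    prob p (PDEvent ends a₁ a₂ a₃ ∩ connEvent ends a₂ o)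

/-- `W = M₂ + Δ_T`. -/
noncomputable def vW (p : E → R) (ends : E → Sym2 V) (a₁ a₂ a₃ b : V) : R :=
  massM2 p ends a₁ a₂ a₃ b + deltaT p ends a₁ a₂ a₃ b

/-- `X = (T_{l→h} − Δ_l) + (T_{h→l} − Δ_h)`, the adaptive margin. -/
noncomputable def vX (p : E → R) (ends : E → Sym2 V) (o a₁ a₂ a₃ b : V) : R :=
  (prob p (PDEvent ends a₁ a₂ a₃ ∩ connEvent ends a₁ o ∩ connEvent ends a₂ b) -
      deltaL p ends o a₁ a₂ a₃ b) +
    (prob p (PDEvent ends a₁ a₂ a₃ ∩ connEvent ends a₂ o ∩ connEvent ends a₁ b) -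
      deltaH p ends o a₁ a₂ a₃ b)

/-- The (ZΔ)-slack as the quadratic form `Z = D_o W − D X`. -/
noncomputable def Zq (p : E → R) (ends : E → Sym2 V) (o a₁ a₂ a₃ b : V) : R :=
  vDo p ends o a₁ a₂ a₃ * vW p ends a₁ a₂ a₃ b - vD p ends a₁ a₂ a₃ * vX p ends o a₁ a₂ a₃ b

/-- **Twice** the polarised form: `polar2 p q = 2 B(v(p), v(q)) = D_o W′ + D′_o W − D X′ − D′ X`
(kept division-free; mine-1's `B = polar2 / 2`, and `B ≥ 0 ↔ polar2 ≥ 0`). -/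
noncomputable def polar2 (p q : E → R) (ends : E → Sym2 V) (o a₁ a₂ a₃ b : V) : R :=
  vDo p ends o a₁ a₂ a₃ * vW q ends a₁ a₂ a₃ b + vDo q ends o a₁ a₂ a₃ * vW p ends a₁ a₂ a₃ b -
    vD p ends a₁ a₂ a₃ * vX q ends o a₁ a₂ a₃ b - vD q ends a₁ a₂ a₃ * vX p ends o a₁ a₂ a₃ b

/-- The labelling gap `P(a₂ ↔ b) − P(a₁ ↔ b)`. -/
noncomputable def labelGap (p : E → R) (ends : E → Sym2 V) (a₁ a₂ b : V) : R :=
  prob p (connEvent ends a₂ b) - prob p (connEvent ends a₁ b)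

/-- The tie point of the edge line: `ε₀ = gap_d / (gap_d − gap_c)`. -/
noncomputable def tiePoint (p : E → R) (ends : E → Sym2 V) (a₁ a₂ b : V) (e : E) : R :=
  labelGap (Function.update p e 0) ends a₁ a₂ b /
    (labelGap (Function.update p e 0) ends a₁ a₂ b - labelGap (Function.update p e 1) ends a₁ a₂ b)

end Vec

section Identities

variable {V : Type*} {E : Type*} [Fintype E] [DecidableEq E] {R : Type*} [Field R]

/-- `Zq` is the (ZΔ)-slack of `ZDelta`. -/
lemma Zq_eq_slack (p : E → R) (ends : E → Sym2 V) (o a₁ a₂ a₃ b : V) :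
    Zq p ends o a₁ a₂ a₃ b =
      (prob p (PDEvent ends a₁ a₂ a₃ ∩ connEvent ends a₁ o) +
            prob p (PDEvent ends a₁ a₂ a₃ ∩ connEvent ends a₂ o)) *
          (massM2 p ends a₁ a₂ a₃ b + deltaT p ends a₁ a₂ a₃ b) -
        ((prob p (PDEvent ends a₁ a₂ a₃ ∩ connEvent ends a₁ o ∩ connEvent ends a₂ b) -
              deltaL p ends o a₁ a₂ a₃ b) +
            (prob p (PDEvent ends a₁ a₂ a₃ ∩ connEvent ends a₂ o ∩ connEvent ends a₁ b) -
              deltaH p ends o a₁ a₂ a₃ b)) * prob p (PDEvent ends a₁ a₂ a₃) := by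
  unfold Zq vDo vW vD vX
  ring

/-- `2 B(v, v) = 2 Z`. -/
lemma polar2_self (p : E → R) (ends : E → Sym2 V) (o a₁ a₂ a₃ b : V) :
    polar2 p p ends o a₁ a₂ a₃ b = 2 * Zq p ends o a₁ a₂ a₃ b := by
  unfold polar2 Zq
  ring

/-- `B` is symmetric. -/
lemma polar2_comm (p q : E → R) (ends : E → Sym2 V) (o a₁ a₂ a₃ b : V) :
    polar2 p q ends o a₁ a₂ a₃ b = polar2 q p ends o a₁ a₂ a₃ b := by
  unfold polar2
  ring

/-- `2 B(v, v′) = Z + Z′ − ΔD_o ΔW + ΔD ΔX` (`Δ` = difference of the two coordinate vectors). -/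
lemma polar2_eq (p q : E → R) (ends : E → Sym2 V) (o a₁ a₂ a₃ b : V) :
    polar2 p q ends o a₁ a₂ a₃ b =
      Zq p ends o a₁ a₂ a₃ b + Zq q ends o a₁ a₂ a₃ b -
        (vDo p ends o a₁ a₂ a₃ - vDo q ends o a₁ a₂ a₃) *
          (vW p ends a₁ a₂ a₃ b - vW q ends a₁ a₂ a₃ b) +
        (vD p ends a₁ a₂ a₃ - vD q ends a₁ a₂ a₃) *
          (vX p ends o a₁ a₂ a₃ b - vX q ends o a₁ a₂ a₃ b) := by
  unfold polar2 Zq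
  ring

/-- `D` is affine in the weight of `e`. -/
lemma vD_pin (p : E → R) (ends : E → Sym2 V) (a₁ a₂ a₃ : V) (e : E) :
    vD p ends a₁ a₂ a₃ =
      p e * vD (Function.update p e 1) ends a₁ a₂ a₃ +
        (1 - p e) * vD (Function.update p e 0) ends a₁ a₂ a₃ :=
  prob_eq_pin p _ e

/-- `D_o` is affine in the weight of `e`. -/
lemma vDo_pin (p : E → R) (ends : E → Sym2 V) (o a₁ a₂ a₃ : V) (e : E) :
    vDo p ends o a₁ a₂ a₃ =
      p e * vDo (Function.update p e 1) ends o a₁ a₂ a₃ +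
        (1 - p e) * vDo (Function.update p e 0) ends o a₁ a₂ a₃ := by
  unfold vDo
  rw [prob_eq_pin p (PDEvent ends a₁ a₂ a₃ ∩ connEvent ends a₁ o) e,
    prob_eq_pin p (PDEvent ends a₁ a₂ a₃ ∩ connEvent ends a₂ o) e]
  ring

/-- `W` is affine in the weight of `e`. -/
lemma vW_pin (p : E → R) (ends : E → Sym2 V) (a₁ a₂ a₃ b : V) (e : E) :
    vW p ends a₁ a₂ a₃ b =
      p e * vW (Function.update p e 1) ends a₁ a₂ a₃ b +
        (1 - p e) * vW (Function.update p e 0) ends a₁ a₂ a₃ b := by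
  unfold vW massM2 deltaT
  rw [prob_eq_pin p (PDEvent ends a₁ a₂ a₃ ∩ connEvent ends a₂ b) e,
    prob_eq_pin p (connEvent ends a₂ b ∩ TEvent ends a₁ a₂ a₃) e,
    prob_eq_pin p (connEvent ends a₁ b ∩ TEvent ends a₁ a₂ a₃) e]
  ring

/-- `X` is affine in the weight of `e`. -/
lemma vX_pin (p : E → R) (ends : E → Sym2 V) (o a₁ a₂ a₃ b : V) (e : E) :
    vX p ends o a₁ a₂ a₃ b =
      p e * vX (Function.update p e 1) ends o a₁ a₂ a₃ b +
        (1 - p e) * vX (Function.update p e 0) ends o a₁ a₂ a₃ b := by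
  unfold vX deltaL deltaH
  rw [prob_eq_pin p (PDEvent ends a₁ a₂ a₃ ∩ connEvent ends a₁ o ∩ connEvent ends a₂ b) e,
    prob_eq_pin p (TEvent ends a₁ a₂ a₃ ∩ connEvent ends a₁ o ∩ connEvent ends a₁ b) e,
    prob_eq_pin p (TEvent ends a₁ a₂ a₃ ∩ connEvent ends a₁ o ∩ connEvent ends a₂ b) e,
    prob_eq_pin p (PDEvent ends a₁ a₂ a₃ ∩ connEvent ends a₂ o ∩ connEvent ends a₁ b) e,
    prob_eq_pin p (TEvent ends a₂ a₁ a₃ ∩ connEvent ends a₂ o ∩ connEvent ends a₂ b) e,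
    prob_eq_pin p (TEvent ends a₂ a₁ a₃ ∩ connEvent ends a₂ o ∩ connEvent ends a₁ b) e]
  ring

/-- The labelling gap is affine in the weight of `e`. -/
lemma labelGap_pin (p : E → R) (ends : E → Sym2 V) (a₁ a₂ b : V) (e : E) :
    labelGap p ends a₁ a₂ b =
      p e * labelGap (Function.update p e 1) ends a₁ a₂ b +
        (1 - p e) * labelGap (Function.update p e 0) ends a₁ a₂ b := by
  unfold labelGap
  rw [prob_eq_pin p (connEvent ends a₂ b) e, prob_eq_pin p (connEvent ends a₁ b) e]
  ring

/-- **The edge-line identity** (MINE-1 §19.1):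
`Z(p) = (1 − p_e)² Z_d + p_e (1 − p_e) · 2B(v_d, v_c) + p_e² Z_c`. -/
theorem Z_edge_line (p : E → R) (ends : E → Sym2 V) (o a₁ a₂ a₃ b : V) (e : E) :
    Zq p ends o a₁ a₂ a₃ b =
      (1 - p e) ^ 2 * Zq (Function.update p e 0) ends o a₁ a₂ a₃ b +
        p e * (1 - p e) *
          polar2 (Function.update p e 0) (Function.update p e 1) ends o a₁ a₂ a₃ b +
        p e ^ 2 * Zq (Function.update p e 1) ends o a₁ a₂ a₃ b := by
  unfold Zq polar2
  rw [vD_pin p ends a₁ a₂ a₃ e, vDo_pin p ends o a₁ a₂ a₃ e, vW_pin p ends a₁ a₂ a₃ b e,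
    vX_pin p ends o a₁ a₂ a₃ b e]
  ring

/-- The coordinates at an intermediate point of the line: `v(p[e ↦ ε]) = ε v_c + (1 − ε) v_d`
(`D`-coordinate; the others are `vDo_at`, `vW_at`, `vX_at`). -/
lemma vD_at (p : E → R) (ends : E → Sym2 V) (a₁ a₂ a₃ : V) (e : E) (ε : R) :
    vD (Function.update p e ε) ends a₁ a₂ a₃ =
      ε * vD (Function.update p e 1) ends a₁ a₂ a₃ +
        (1 - ε) * vD (Function.update p e 0) ends a₁ a₂ a₃ := by
  have h := vD_pin (Function.update p e ε) ends a₁ a₂ a₃ e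
  rwa [Function.update_self, Function.update_idem, Function.update_idem] at h

/-- `D_o` at an intermediate point. -/
lemma vDo_at (p : E → R) (ends : E → Sym2 V) (o a₁ a₂ a₃ : V) (e : E) (ε : R) :
    vDo (Function.update p e ε) ends o a₁ a₂ a₃ =
      ε * vDo (Function.update p e 1) ends o a₁ a₂ a₃ +
        (1 - ε) * vDo (Function.update p e 0) ends o a₁ a₂ a₃ := by
  have h := vDo_pin (Function.update p e ε) ends o a₁ a₂ a₃ e
  rwa [Function.update_self, Function.update_idem, Function.update_idem] at h

/-- `W` at an intermediate point. -/
lemma vW_at (p : E → R) (ends : E → Sym2 V) (a₁ a₂ a₃ b : V) (e : E) (ε : R) :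
    vW (Function.update p e ε) ends a₁ a₂ a₃ b =
      ε * vW (Function.update p e 1) ends a₁ a₂ a₃ b +
        (1 - ε) * vW (Function.update p e 0) ends a₁ a₂ a₃ b := by
  have h := vW_pin (Function.update p e ε) ends a₁ a₂ a₃ b e
  rwa [Function.update_self, Function.update_idem, Function.update_idem] at h

/-- `X` at an intermediate point. -/
lemma vX_at (p : E → R) (ends : E → Sym2 V) (o a₁ a₂ a₃ b : V) (e : E) (ε : R) :
    vX (Function.update p e ε) ends o a₁ a₂ a₃ b =
      ε * vX (Function.update p e 1) ends o a₁ a₂ a₃ b +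
        (1 - ε) * vX (Function.update p e 0) ends o a₁ a₂ a₃ b := by
  have h := vX_pin (Function.update p e ε) ends o a₁ a₂ a₃ b e
  rwa [Function.update_self, Function.update_idem, Function.update_idem] at h

/-- The gap at an intermediate point. -/
lemma labelGap_at (p : E → R) (ends : E → Sym2 V) (a₁ a₂ b : V) (e : E) (ε : R) :
    labelGap (Function.update p e ε) ends a₁ a₂ b =
      ε * labelGap (Function.update p e 1) ends a₁ a₂ b +
        (1 - ε) * labelGap (Function.update p e 0) ends a₁ a₂ b := by
  have h := labelGap_pin (Function.update p e ε) ends a₁ a₂ b e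
  rwa [Function.update_self, Function.update_idem, Function.update_idem] at h

/-- **The mixed coefficient of the labelled sub-segment `[v(ε), v_c]`** (mine-1's `B′`), doubled:
`2B(v(ε), v_c) = (1 − ε) · 2B(v_d, v_c) + ε · 2 Z_c`. -/
theorem polar2_tie_right (p : E → R) (ends : E → Sym2 V) (o a₁ a₂ a₃ b : V) (e : E) (ε : R) :
    polar2 (Function.update p e ε) (Function.update p e 1) ends o a₁ a₂ a₃ b =
      (1 - ε) * polar2 (Function.update p e 0) (Function.update p e 1) ends o a₁ a₂ a₃ b +
        ε * (2 * Zq (Function.update p e 1) ends o a₁ a₂ a₃ b) := by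
  unfold polar2 Zq
  rw [vD_at p ends a₁ a₂ a₃ e ε, vDo_at p ends o a₁ a₂ a₃ e ε, vW_at p ends a₁ a₂ a₃ b e ε,
    vX_at p ends o a₁ a₂ a₃ b e ε]
  ring

/-- **The mixed coefficient of the labelled sub-segment `[v_d, v(ε)]`**, doubled:
`2B(v_d, v(ε)) = (1 − ε) · 2 Z_d + ε · 2B(v_d, v_c)`. -/
theorem polar2_tie_left (p : E → R) (ends : E → Sym2 V) (o a₁ a₂ a₃ b : V) (e : E) (ε : R) :
    polar2 (Function.update p e 0) (Function.update p e ε) ends o a₁ a₂ a₃ b =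
      (1 - ε) * (2 * Zq (Function.update p e 0) ends o a₁ a₂ a₃ b) +
        ε * polar2 (Function.update p e 0) (Function.update p e 1) ends o a₁ a₂ a₃ b := by
  unfold polar2 Zq
  rw [vD_at p ends a₁ a₂ a₃ e ε, vDo_at p ends o a₁ a₂ a₃ e ε, vW_at p ends a₁ a₂ a₃ b e ε,
    vX_at p ends o a₁ a₂ a₃ b e ε]
  ring

/-- The gap vanishes at the tie point (when the line is not gap-constant). -/
theorem labelGap_tiePoint (p : E → R) (ends : E → Sym2 V) (a₁ a₂ b : V) (e : E)
    (h : labelGap (Function.update p e 0) ends a₁ a₂ b ≠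
      labelGap (Function.update p e 1) ends a₁ a₂ b) :
    labelGap (Function.update p e (tiePoint p ends a₁ a₂ b e)) ends a₁ a₂ b = 0 := by
  rw [labelGap_at]
  unfold tiePoint
  have hne : labelGap (Function.update p e 0) ends a₁ a₂ b -
      labelGap (Function.update p e 1) ends a₁ a₂ b ≠ 0 := sub_ne_zero.2 h
  field_simp
  ring

end Identities

section Props

variable {V : Type*} {E : Type*} [Fintype E] [DecidableEq E] {R : Type*} [Field R]
  [LinearOrder R] [IsStrictOrderedRing R]

/-- **`ZDelta ↔ 0 ≤ Zq`**. -/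
theorem ZDelta_iff_Zq (p : E → R) (ends : E → Sym2 V) (o a₁ a₂ a₃ b : V) :
    ZDelta p ends o a₁ a₂ a₃ b ↔ 0 ≤ Zq p ends o a₁ a₂ a₃ b := by
  rw [Zq_eq_slack]
  unfold ZDelta
  constructor
  · intro h
    linarith
  · intro h
    linarith

/-- The line `p_e = ε` keeps the labelling at both ends (NO-FLIP). -/
def NoFlip (p : E → R) (ends : E → Sym2 V) (a₁ a₂ b : V) (e : E) : Prop :=
  0 ≤ labelGap (Function.update p e 0) ends a₁ a₂ b ∧
    0 ≤ labelGap (Function.update p e 1) ends a₁ a₂ b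

/-- **POLAR** (MINE-1 §19.2): the mixed coefficient of the edge line is non-negative,
`B(v_d, v_c) ≥ 0` (stated as `2B ≥ 0`). -/
def Polar (p : E → R) (ends : E → Sym2 V) (o a₁ a₂ a₃ b : V) (e : E) : Prop :=
  0 ≤ polar2 (Function.update p e 0) (Function.update p e 1) ends o a₁ a₂ a₃ b

/-- **SEG-POLAR, upward flip** (`gap_d < 0 ≤ gap_c`): the mixed coefficient of the labelled
sub-segment `[v(ε₀), v_c]`, `B(v(ε₀), v_c) = (1 − ε₀) B(v_d, v_c) + ε₀ Z_c`, is non-negative. -/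
def SegPolarUp (p : E → R) (ends : E → Sym2 V) (o a₁ a₂ a₃ b : V) (e : E) : Prop :=
  0 ≤ polar2 (Function.update p e (tiePoint p ends a₁ a₂ b e)) (Function.update p e 1)
    ends o a₁ a₂ a₃ b

/-- **SEG-POLAR, downward flip** (`gap_d ≥ 0 > gap_c`): the mixed coefficient of the labelled
sub-segment `[v_d, v(ε₀)]`, `B(v_d, v(ε₀)) = (1 − ε₀) Z_d + ε₀ B(v_d, v_c)`, is non-negative. -/
def SegPolarDown (p : E → R) (ends : E → Sym2 V) (o a₁ a₂ a₃ b : V) (e : E) : Prop :=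
  0 ≤ polar2 (Function.update p e 0) (Function.update p e (tiePoint p ends a₁ a₂ b e))
    ends o a₁ a₂ a₃ b

end Props

section Closures

variable (R : Type*) [Field R] [LinearOrder R] [IsStrictOrderedRing R]

/-- **POLAR for every finite graph, edge and no-flip line** (census 0 / 120,923,258 at n = 7). -/
def Polar_all : Prop :=
  ∀ (V E : Type) [Fintype V] [DecidableEq V] [Fintype E] [DecidableEq E]
    (ends : E → Sym2 V) (p : E → R), IsProbVec p →
    ∀ o a₁ a₂ a₃ b : V, a₁ ≠ a₂ → a₁ ≠ a₃ → a₂ ≠ a₃ → o ≠ a₁ → o ≠ a₂ → o ≠ a₃ → o ≠ b →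
      b ≠ a₁ → b ≠ a₂ → b ≠ a₃ →
      ∀ e : E, NoFlip p ends a₁ a₂ b e → Polar p ends o a₁ a₂ a₃ b e

/-- **SEG-POLAR for every finite graph, edge and flip line** (census 0 / 35,538,502 at n = 7). -/
def SegPolar_all : Prop :=
  ∀ (V E : Type) [Fintype V] [DecidableEq V] [Fintype E] [DecidableEq E]
    (ends : E → Sym2 V) (p : E → R), IsProbVec p →
    ∀ o a₁ a₂ a₃ b : V, a₁ ≠ a₂ → a₁ ≠ a₃ → a₂ ≠ a₃ → o ≠ a₁ → o ≠ a₂ → o ≠ a₃ → o ≠ b →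
      b ≠ a₁ → b ≠ a₂ → b ≠ a₃ →
      ∀ e : E,
        (labelGap (Function.update p e 0) ends a₁ a₂ b < 0 →
          0 ≤ labelGap (Function.update p e 1) ends a₁ a₂ b →
          SegPolarUp p ends o a₁ a₂ a₃ b e) ∧
        (0 ≤ labelGap (Function.update p e 0) ends a₁ a₂ b →
          labelGap (Function.update p e 1) ends a₁ a₂ b < 0 →
          SegPolarDown p ends o a₁ a₂ a₃ b e)

end Closures

end ZLine

end Summit.Ventures.PercRepro2
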